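import Literature.Analysis.FluidPDE.KNSSRegularityDecomposition
import Literature.Analysis.FluidPDE.OseenBoundedFieldsContinuity
import Literature.Analysis.FluidPDE.OseenSlice
import Literature.Analysis.UnboundedOperators.HeatKernelGaussianData
import HarnessLib

/-!
# Tools for the mildness clause of KNSS 2009, Theorem 6.1: a.e. invariance of the drift-Duhamel
# term and time continuity of the Oseen Duhamel term of bounded fields

Analysis/FluidPDE support file (everything proved; no definitions, no named facts) on the
discharge path of `Literature.Analysis.FluidPDE.KNSS2009_oseenMild_of_cylRadius_decay`
(`KNSSOseenMildDecay.lean`; Koch–Nadirashvili–Seregin–Šverák 2009, Theorem 6.1, mildness clause: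
a bounded solution with the horizontal decay `|u| ≤ C/|x'|` is a mild solution, arXiv:0709.3599
pp. 11–12). The discharge consumes KNSS's Lemma 3.1 in drift-mild form
(`KNSS2009_weak_driftMild`: `u = U + b(t)` a.e. with
`U(t) = e^{(t−s)Δ}U(s) − ∫ₛᵗ e^{(t−σ)Δ}P∇·(u ⊗ u) dσ`), kills the drift by the decay, and has to
pass from identities valid for a.e. time to all times. Three tools for this are proved here:

* `oseenHeat_congr_ae`, `driftTensor_congr_ae`, `driftDuhamel_congr_ae` — the Oseen–heat operator
  and the drift-Duhamel integral `driftDuhamel U b s t x` only see the **a.e. class** of the data,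
  resp. of the full velocity `U(σ) + b(σ)` for a.e. `σ ∈ (s, t)` (the operator is built from
  caloric extensions, `heatExtension_congr_ae'`);
* `enorm_oseenDuhamel_early_sub_le`, `continuousOn_oseenDuhamel_time` — **the Duhamel term
  `t ↦ B^ν_s(u,u)(t)(x)` of a bounded jointly measurable field is continuous on `[s, T]` at every
  point `x`**: for `t ≤ t'` the early part `B^ν_s(1_{<t}u, 1_{<t}u)(t')` differs from
  `B^ν_s(u,u)(t)` by at most `M² ∫₀^{T−s} ‖K(ν(σ + t'−t)) − K(νσ)‖_{L¹} dσ` (pointwise twin of the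
  `L³` increment estimate of `OseenBoundedFieldsContinuity.lean`, through the basis majorant
  `norm_oseenKernel_sub_le_sum_basis`), which tends to `0` with `t' − t` by the `L¹` time
  continuity of the kernel (`tendsto_lintegral_sum_norm_oseenKernel_sub`), while the late part
  `B^ν_t(u,u)(t')` is `O(√(t'−t))` (`exists_norm_oseenDuhamel_bounded_le`); the modulus is uniform
  in `t`;
* `oseenDuhamel_comp_add_right` — space translation covariance of the Duhamel term (used, with
  the tree's `heatExtension_comp_add_right` for the caloric term, to read the decay at horizontal
  infinity off pointwise dominated convergence of translates).

## References

* G. Koch, N. Nadirashvili, G. Seregin, V. Šverák, *Liouville theorems for the Navier–Stokes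
  equations and applications*, Acta Math. 203 (2009) = arXiv:0709.3599, §3 (3.3), (3.8),
  Lemma 3.1 (pp. 6–7); §4 (4.3)–(4.4) (p. 8); Thm. 6.1 and its proof (pp. 11–12).
  [KochNadirashviliSereginSverak2009]
* P. G. Lemarié-Rieusset, *The Navier–Stokes Problem in the 21st Century*, CRC Press 2016, proof
  of Thm. 7.5 (time continuity of the bilinear term). [LemarieRieusset2016]
-/

noncomputable section

open MeasureTheory Set Function Filter TopologicalSpace InnerProductSpace Metric
open _root_.Topology
open scoped RealInnerProductSpace NNReal ENNReal

namespace Literature.Analysis.FluidPDE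

variable {E : Type*} [NormedAddCommGroup E] [InnerProductSpace ℝ E] [FiniteDimensional ℝ E]
  [MeasurableSpace E] [BorelSpace E]

/-! ### The Oseen–heat operator and the drift-Duhamel term only see a.e. classes -/

section Congr

/-- `∂ᵥe^{sΔ}φ` only depends on the a.e. class of `φ`. [folklore] -/
theorem heatD1_congr_ae {φ φ' : E → ℝ} (h : φ =ᵐ[volume] φ') (s : ℝ) (v : E) :
    heatD1 s v φ = heatD1 s v φ' := by
  funext x
  simp only [heatD1, UnboundedOperators.heatExtension_congr_ae' h s]

/-- `∂ᵤ∂ᵥ∂_w e^{sΔ}φ` only depends on the a.e. class of `φ`. [folklore] -/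
theorem heatD3_congr_ae {φ φ' : E → ℝ} (h : φ =ᵐ[volume] φ') (s : ℝ) (u v w : E) :
    heatD3 s u v w φ = heatD3 s u v w φ' := by
  funext x
  simp only [heatD3, UnboundedOperators.heatExtension_congr_ae' h s]

/-- **The Oseen–heat operator only sees the a.e. class of the tensor**: if `Fⱼₖ = F'ⱼₖ` a.e. for
all `j, k` then `𝒩_τ F = 𝒩_τ F'` pointwise (it is built from caloric extensions). [folklore] -/
theorem oseenHeat_congr_ae {F F' : Fin (Module.finrank ℝ E) → Fin (Module.finrank ℝ E) → E → ℝ}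
    (h : ∀ j k, F j k =ᵐ[volume] F' j k) (τ : ℝ) (i : Fin (Module.finrank ℝ E)) (x : E) :
    oseenHeat τ F i x = oseenHeat τ F' i x := by
  have h1 : ∀ j s v, heatD1 s v (F j i) = heatD1 s v (F' j i) := fun j s v =>
    heatD1_congr_ae (h j i) s v
  have h3 : ∀ j k s a c d, heatD3 s a c d (F j k) = heatD3 s a c d (F' j k) := fun j k s a c d =>
    heatD3_congr_ae (h j k) s a c d
  simp only [oseenHeat, h1, h3]

/-- The drift tensor of two velocities with a.e. equal full velocity `U(σ) + b(σ)` agree a.e.,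
componentwise. [folklore] -/
theorem driftTensor_congr_ae {U U' : ℝ → E → E} {b b' : ℝ → E} {σ : ℝ}
    (h : (fun y => U σ y + b σ) =ᵐ[volume] fun y => U' σ y + b' σ) (j k : Fin (Module.finrank ℝ E)) :
    driftTensor U b σ j k =ᵐ[volume] driftTensor U' b' σ j k := by
  filter_upwards [h] with y hy
  simp only [driftTensor_apply, hy]

/-- **The drift-Duhamel term only sees the a.e. class of the full velocity**: if
`U(σ) + b(σ) = U'(σ) + b'(σ)` a.e. in space for a.e. `σ ∈ (s, t)` (`s ≤ t`), then
`driftDuhamel U b s t x = driftDuhamel U' b' s t x` for every `x`. [folklore] -/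
theorem driftDuhamel_congr_ae {U U' : ℝ → E → E} {b b' : ℝ → E} {s t : ℝ} (hst : s ≤ t)
    (h : ∀ᵐ σ ∂((volume : Measure ℝ).restrict (Ioo s t)),
      (fun y => U σ y + b σ) =ᵐ[volume] fun y => U' σ y + b' σ) (x : E) :
    driftDuhamel U b s t x = driftDuhamel U' b' s t x := by
  rw [driftDuhamel_apply, driftDuhamel_apply, intervalIntegral.integral_of_le hst,
    intervalIntegral.integral_of_le hst, integral_Ioc_eq_integral_Ioo, integral_Ioc_eq_integral_Ioo]
  refine integral_congr_ae ?_
  filter_upwards [h] with σ hσ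
  refine Finset.sum_congr rfl fun i _ => ?_
  rw [oseenHeat_congr_ae (fun j k => driftTensor_congr_ae hσ j k)]

end Congr

/-! ### Time continuity of the Duhamel term of bounded fields, pointwise -/

section TimeContinuity

variable {ν s T M : ℝ} {u : ℝ → E → E}

/-- **The pointwise increment estimate**: for `u` jointly measurable and bounded by `M` on
`(s, T) × E`, `ν > 0`, `s < t ≤ t' ≤ T` and every `x`,
`‖B^ν_s(1_{<t}u, 1_{<t}u)(t')(x) − B^ν_s(u,u)(t)(x)‖ ≤ M² ∫_{(0,T−s)} ‖K(ν(σ + (t'−t))) − K(νσ)‖ dσ`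
with the basis majorant of the kernel increment (in `ℝ≥0∞`; pointwise twin of
`eLpNorm_oseenDuhamel_increment_le`). [folklore] -/
theorem enorm_oseenDuhamel_early_sub_le (hν : 0 < ν)
    (hum : AEStronglyMeasurable (uncurry u) ((volume : Measure (ℝ × E)).restrict (Ioo s T ×ˢ univ)))
    (hM : 0 ≤ M) (huM : ∀ τ ∈ Ioo s T, ∀ y, ‖u τ y‖ ≤ M)
    {t t' : ℝ} (hst : s < t) (htt' : t ≤ t') (ht'T : t' ≤ T) (x : E) :
    ‖oseenDuhamel ν s ((Iio t).indicator u) ((Iio t).indicator u) t' x - oseenDuhamel ν s u u t x‖ₑ ≤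
      ENNReal.ofReal (M * M) * ∫⁻ σ in Ioo 0 (T - s), ∫⁻ z, ENNReal.ofReal
        (∑ i, ∑ j, ‖oseenKernel (ν * (σ + (t' - t))) z (stdOrthonormalBasis ℝ E i) (stdOrthonormalBasis ℝ E j) -
          oseenKernel (ν * σ) z (stdOrthonormalBasis ℝ E i) (stdOrthonormalBasis ℝ E j)‖) := by
  set e := stdOrthonormalBasis ℝ E with he
  have htT : t ≤ T := htt'.trans ht'T
  have hst' : s < t' := hst.trans_le htt'
  -- the two time integrands
  set f : ℝ → E := fun τ => ∫ y, oseenKernel (ν * (t' - τ)) (x - y) (u τ y) (u τ y) with hf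
  set g : ℝ → E := fun τ => ∫ y, oseenKernel (ν * (t - τ)) (x - y) (u τ y) (u τ y) with hg
  have hearly : oseenDuhamel ν s ((Iio t).indicator u) ((Iio t).indicator u) t' x = ∫ τ in Ioo s t, f τ :=
    oseenDuhamel_indicator_Iio htt' x
  have hB : oseenDuhamel ν s u u t x = ∫ τ in Ioo s t, g τ := oseenDuhamel_apply ν s u u t x
  -- integrability of `g`
  have hg_int : Integrable g ((volume : Measure ℝ).restrict (Ioo s t)) := by
    have h := integrable_oseenKernel_duhamel_bounded hν hum hum hM huM huM hst htT x
    rw [volume_restrict_prod_univ_eq_prod] at h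
    exact h.integral_prod_left
  -- integrability of `f` (marginal of the Duhamel integrand of the truncated fields on `(s, t')`)
  have hf_int : Integrable f ((volume : Measure ℝ).restrict (Ioo s t)) := by
    have hum' := aestronglyMeasurable_uncurry_indicator_Iio' (s := s) (T := T) t hum
    have huM' : ∀ τ ∈ Ioo s T, ∀ y, ‖(Iio t).indicator u τ y‖ ≤ M := fun τ hτ y =>
      norm_indicator_Iio_le huM hM τ hτ y
    have h := integrable_oseenKernel_duhamel_bounded hν hum' hum' hM huM' huM' hst' ht'T x
    rw [volume_restrict_prod_univ_eq_prod] at h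
    have h1 : Integrable (fun τ => ∫ y, oseenKernel (ν * (t' - τ)) (x - y)
        ((Iio t).indicator u τ y) ((Iio t).indicator u τ y)) ((volume : Measure ℝ).restrict (Ioo s t)) :=
      h.integral_prod_left.mono_measure (Measure.restrict_mono (Ioo_subset_Ioo_right htt') le_rfl)
    refine h1.congr ((ae_restrict_mem measurableSet_Ioo).mono fun τ hτ => ?_)
    simp only [hf, indicator_Iio_apply_of_lt hτ.2]
  -- slice measurability at a.e. `τ`
  have hum_t : AEStronglyMeasurable (uncurry u) ((volume.restrict (Ioo s t)).prod (volume : Measure E)) := by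
    rw [← volume_restrict_prod_univ_eq_prod]
    exact hum.mono_measure (Measure.restrict_mono (prod_mono (Ioo_subset_Ioo_right htT) Subset.rfl) le_rfl)
  have hsl : ∀ᵐ τ ∂((volume : Measure ℝ).restrict (Ioo s t)), AEStronglyMeasurable (fun y => u τ y) volume :=
    hum_t.prodMk_left
  -- the difference as one integral, and its pointwise majorant
  rw [hearly, hB, ← integral_sub hf_int hg_int]
  set S : ℝ → E → ℝ := fun σ z => ∑ i, ∑ j,
    ‖oseenKernel (ν * (σ + (t' - t))) z (e i) (e j) - oseenKernel (ν * σ) z (e i) (e j)‖ with hS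
  have hS0 : ∀ σ z, 0 ≤ S σ z := fun σ z =>
    Finset.sum_nonneg fun i _ => Finset.sum_nonneg fun j _ => norm_nonneg _
  have hpt : ∀ᵐ τ ∂((volume : Measure ℝ).restrict (Ioo s t)),
      ‖f τ - g τ‖ₑ ≤ ENNReal.ofReal (M * M) * ∫⁻ z, ENNReal.ofReal (S (t - τ) z) := by
    filter_upwards [hsl, ae_restrict_mem measurableSet_Ioo] with τ hτm hτ
    have hσ : 0 < ν * (t - τ) := mul_pos hν (sub_pos.2 hτ.2)
    have hσ' : 0 < ν * (t' - τ) := mul_pos hν (by linarith [hτ.2])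
    have hτT : τ ∈ Ioo s T := ⟨hτ.1, hτ.2.trans_le htT⟩
    have hi' := integrable_oseenKernel_slice_of_bound hσ' hτm hτm (huM τ hτT) (huM τ hτT) x
    have hi := integrable_oseenKernel_slice_of_bound hσ hτm hτm (huM τ hτT) (huM τ hτT) x
    have hsub : f τ - g τ = ∫ y, (oseenKernel (ν * (t' - τ)) (x - y) (u τ y) (u τ y) -
        oseenKernel (ν * (t - τ)) (x - y) (u τ y) (u τ y)) := by
      rw [hf, hg]; exact (integral_sub hi' hi).symm
    rw [hsub]
    calc ‖∫ y, (oseenKernel (ν * (t' - τ)) (x - y) (u τ y) (u τ y) -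
          oseenKernel (ν * (t - τ)) (x - y) (u τ y) (u τ y))‖ₑ
        ≤ ∫⁻ y, ‖oseenKernel (ν * (t' - τ)) (x - y) (u τ y) (u τ y) -
          oseenKernel (ν * (t - τ)) (x - y) (u τ y) (u τ y)‖ₑ := enorm_integral_le_lintegral_enorm _
      _ ≤ ∫⁻ y, ENNReal.ofReal (M * M) * ENNReal.ofReal (S (t - τ) (x - y)) := by
          refine lintegral_mono fun y => ?_
          rw [← ofReal_norm, ← ENNReal.ofReal_mul (mul_nonneg hM hM)]
          refine ENNReal.ofReal_le_ofReal ?_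
          have hk := norm_oseenKernel_sub_le_sum_basis e (ν * (t' - τ)) (ν * (t - τ)) (x - y) (u τ y) (u τ y)
          have e1 : ν * (t' - τ) = ν * ((t - τ) + (t' - t)) := by ring
          calc ‖oseenKernel (ν * (t' - τ)) (x - y) (u τ y) (u τ y) -
                oseenKernel (ν * (t - τ)) (x - y) (u τ y) (u τ y)‖
              ≤ S (t - τ) (x - y) * ‖u τ y‖ * ‖u τ y‖ := by rw [hS]; dsimp only; rw [← e1]; exact hk
            _ ≤ S (t - τ) (x - y) * M * M := by
                have h0 := hS0 (t - τ) (x - y)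
                have h1 := huM τ hτT y
                have h2 : 0 ≤ ‖u τ y‖ := norm_nonneg _
                gcongr
            _ = M * M * S (t - τ) (x - y) := by ring
      _ = ENNReal.ofReal (M * M) * ∫⁻ y, ENNReal.ofReal (S (t - τ) (x - y)) := lintegral_const_mul' _ _
          ENNReal.ofReal_ne_top
      _ = ENNReal.ofReal (M * M) * ∫⁻ z, ENNReal.ofReal (S (t - τ) z) := by
          rw [lintegral_sub_left_eq_self (fun z => ENNReal.ofReal (S (t - τ) z)) x]
  -- integrate in `τ`, reflect and enlarge the window
  calc ‖∫ τ in Ioo s t, (f τ - g τ)‖ₑ ≤ ∫⁻ τ in Ioo s t, ‖f τ - g τ‖ₑ := enorm_integral_le_lintegral_enorm _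
    _ ≤ ∫⁻ τ in Ioo s t, ENNReal.ofReal (M * M) * ∫⁻ z, ENNReal.ofReal (S (t - τ) z) := lintegral_mono_ae hpt
    _ = ENNReal.ofReal (M * M) * ∫⁻ τ in Ioo s t, ∫⁻ z, ENNReal.ofReal (S (t - τ) z) :=
        lintegral_const_mul' _ _ ENNReal.ofReal_ne_top
    _ = ENNReal.ofReal (M * M) * ∫⁻ σ in Ioo 0 (t - s), ∫⁻ z, ENNReal.ofReal (S σ z) := by
        rw [setLIntegral_Ioo_reflect_sub s t (fun σ => ∫⁻ z, ENNReal.ofReal (S σ z))]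
    _ ≤ ENNReal.ofReal (M * M) * ∫⁻ σ in Ioo 0 (T - s), ∫⁻ z, ENNReal.ofReal (S σ z) := by
        gcongr ?_ * ?_
        · exact le_rfl
        · exact lintegral_mono_set (Ioo_subset_Ioo_right (by linarith))

/-- **Time continuity of the Duhamel term of bounded fields, pointwise** (Lemarié-Rieusset 2016,
proof of Thm. 7.5, with both factors in `L^∞`): for `u` jointly measurable and bounded by `M` on
`(s, T) × E` and `ν > 0`, the map `t ↦ B^ν_s(u,u)(t)(x)` is continuous on `[s, T]` for every `x`
(splitting at the earlier time: the early increment is controlled by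
`enorm_oseenDuhamel_early_sub_le` and the `L¹` time continuity of the kernel, the late piece by
`C M² ν^{-1/2} 2√(t'−t)`). [cite: LemarieRieusset2016, proof of Thm 7.5 (PDF pp. 157–158)] -/
theorem continuousOn_oseenDuhamel_time (hν : 0 < ν)
    (hum : AEStronglyMeasurable (uncurry u) ((volume : Measure (ℝ × E)).restrict (Ioo s T ×ˢ univ)))
    (hM : 0 ≤ M) (huM : ∀ τ ∈ Ioo s T, ∀ y, ‖u τ y‖ ≤ M) (x : E) :
    ContinuousOn (fun t => oseenDuhamel ν s u u t x) (Icc s T) := by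
  rcases le_or_gt T s with hTs | hsT
  · exact (subsingleton_Icc_of_ge hTs).continuousOn _
  obtain ⟨C, hC, hBd⟩ := exists_norm_oseenDuhamel_bounded_le (E := E)
  set e := stdOrthonormalBasis ℝ E with he
  -- the kernel modulus
  set J : ℝ → ℝ≥0∞ := fun h => ∫⁻ σ in Ioo 0 (T - s), ∫⁻ z, ENNReal.ofReal
    (∑ i, ∑ j, ‖oseenKernel (ν * (σ + h)) z (e i) (e j) - oseenKernel (ν * σ) z (e i) (e j)‖) with hJ
  have hJlim : Tendsto J (𝓝[>] 0) (𝓝 0) := tendsto_lintegral_sum_norm_oseenKernel_sub hν (sub_pos.2 hsT)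
  set A : ℝ := C * M ^ 2 * ν ^ (-(1 / 2 : ℝ)) with hA
  have hA0 : 0 ≤ A := by positivity
  -- the two-time bound for `s ≤ a ≤ b ≤ T`
  have key : ∀ a b : ℝ, s ≤ a → a ≤ b → b ≤ T →
      ‖oseenDuhamel ν s u u b x - oseenDuhamel ν s u u a x‖ₑ ≤
        ENNReal.ofReal (M * M) * J (b - a) + ENNReal.ofReal (A * (2 * Real.sqrt (b - a))) := by
    intro a b hsa hab hbT
    rcases hab.eq_or_lt with heq | hlt
    · subst heq; simp
    have hlate : ‖oseenDuhamel ν a u u b x‖ ≤ A * (2 * Real.sqrt (b - a)) :=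
      hBd hν hlt hM (fun τ hτ y => huM τ ⟨hsa.trans_lt hτ.1, hτ.2.trans_le hbT⟩ y)
        (fun τ hτ y => huM τ ⟨hsa.trans_lt hτ.1, hτ.2.trans_le hbT⟩ y) x
    rcases hsa.eq_or_lt with hse | hsa'
    · -- `a = s`: the Duhamel term over the empty window vanishes
      subst hse
      rw [oseenDuhamel_eq_zero_of_le (le_refl s) x, sub_zero]
      calc ‖oseenDuhamel ν s u u b x‖ₑ ≤ ENNReal.ofReal (A * (2 * Real.sqrt (b - s))) := by
            rw [← ofReal_norm]; exact ENNReal.ofReal_le_ofReal hlate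
        _ ≤ _ := le_add_self
    · rw [oseenDuhamel_eq_indicator_add hν hum hum hM huM huM hsa'.le hab (hsa'.trans_le hab) hbT x]
      calc ‖oseenDuhamel ν s ((Iio a).indicator u) ((Iio a).indicator u) b x + oseenDuhamel ν a u u b x -
            oseenDuhamel ν s u u a x‖ₑ
          = ‖(oseenDuhamel ν s ((Iio a).indicator u) ((Iio a).indicator u) b x - oseenDuhamel ν s u u a x) +
              oseenDuhamel ν a u u b x‖ₑ := by abel_nf
        _ ≤ ‖oseenDuhamel ν s ((Iio a).indicator u) ((Iio a).indicator u) b x - oseenDuhamel ν s u u a x‖ₑ +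
              ‖oseenDuhamel ν a u u b x‖ₑ := enorm_add_le _ _
        _ ≤ ENNReal.ofReal (M * M) * J (b - a) + ENNReal.ofReal (A * (2 * Real.sqrt (b - a))) := by
            refine add_le_add (enorm_oseenDuhamel_early_sub_le hν hum hM huM hsa' hab hbT x) ?_
            rw [← ofReal_norm]; exact ENNReal.ofReal_le_ofReal hlate
  -- continuity from the uniform modulus
  refine Metric.continuousOn_iff.2 fun t₀ ht₀ ε hε => ?_
  -- the kernel part below `ε/3`
  have hε3 : 0 < ε / 3 / (M * M + 1) := by positivity
  have hev : ∀ᶠ h in 𝓝[>] (0 : ℝ), J h ≤ ENNReal.ofReal (ε / 3 / (M * M + 1)) :=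
    ENNReal.tendsto_nhds_zero.1 hJlim _ (by simpa using hε3)
  rw [eventually_nhdsWithin_iff, Metric.eventually_nhds_iff] at hev
  obtain ⟨δ₁, hδ₁, hJδ⟩ := hev
  -- the late part below `ε/3`
  set δ₂ : ℝ := (ε / 3 / (2 * A + 1)) ^ 2 with hδ₂
  have hδ₂0 : 0 < δ₂ := by positivity
  refine ⟨min δ₁ δ₂, lt_min hδ₁ hδ₂0, fun t ht hdist => ?_⟩
  -- order the two times
  set a : ℝ := min t t₀ with ha
  set b : ℝ := max t t₀ with hb
  have hsa : s ≤ a := le_min ht.1 ht₀.1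
  have hbT : b ≤ T := max_le ht.2 ht₀.2
  have hab : a ≤ b := min_le_max
  have hba : b - a = |t - t₀| := by
    rw [ha, hb]
    rcases le_total t t₀ with h | h
    · rw [min_eq_left h, max_eq_right h, abs_of_nonpos (by linarith), neg_sub]
    · rw [min_eq_right h, max_eq_left h, abs_of_nonneg (by linarith)]
  have hh : b - a < min δ₁ δ₂ := by rw [hba, ← Real.dist_eq]; exact hdist
  have hh0 : 0 ≤ b - a := sub_nonneg.2 hab
  -- bound the two pieces
  have h1 : ENNReal.ofReal (M * M) * J (b - a) ≤ ENNReal.ofReal (ε / 3) := by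
    rcases hh0.eq_or_lt with hz | hpos
    · rw [← hz]
      have : J 0 = 0 := by simp [hJ]
      rw [this, mul_zero]; exact bot_le
    · have hJb : J (b - a) ≤ ENNReal.ofReal (ε / 3 / (M * M + 1)) :=
        hJδ (by rw [Real.dist_eq, sub_zero, abs_of_pos hpos]; exact hh.trans_le (min_le_left _ _)) hpos
      calc ENNReal.ofReal (M * M) * J (b - a) ≤ ENNReal.ofReal (M * M) * ENNReal.ofReal (ε / 3 / (M * M + 1)) := by
            gcongr
        _ = ENNReal.ofReal (M * M * (ε / 3 / (M * M + 1))) := (ENNReal.ofReal_mul (mul_nonneg hM hM)).symm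
        _ ≤ ENNReal.ofReal (ε / 3) := by
            refine ENNReal.ofReal_le_ofReal ?_
            rw [mul_div_assoc', div_le_iff₀ (by positivity : (0 : ℝ) < M * M + 1)]
            nlinarith [mul_nonneg hM hM, hε.le]
  have h2 : ENNReal.ofReal (A * (2 * Real.sqrt (b - a))) ≤ ENNReal.ofReal (ε / 3) := by
    refine ENNReal.ofReal_le_ofReal ?_
    have hsq : Real.sqrt (b - a) ≤ ε / 3 / (2 * A + 1) := by
      rw [Real.sqrt_le_left (by positivity)]
      exact (hh.trans_le (min_le_right _ _)).le
    calc A * (2 * Real.sqrt (b - a)) ≤ A * (2 * (ε / 3 / (2 * A + 1))) := by gcongr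
      _ = (2 * A) / (2 * A + 1) * (ε / 3) := by ring
      _ ≤ 1 * (ε / 3) := by
          gcongr
          rw [div_le_one (by positivity)]; linarith
      _ = ε / 3 := one_mul _
  have hkey := (key a b hsa hab hbT).trans (add_le_add h1 h2)
  -- back to `dist`
  have hed : edist (oseenDuhamel ν s u u t x) (oseenDuhamel ν s u u t₀ x) ≤
      ENNReal.ofReal (ε / 3) + ENNReal.ofReal (ε / 3) := by
    rcases le_total t t₀ with h | h
    · have e1 : a = t := by rw [ha, min_eq_left h]
      have e2 : b = t₀ := by rw [hb, max_eq_right h]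
      rw [edist_comm, edist_eq_enorm_sub, ← e1, ← e2]; exact hkey
    · have e1 : a = t₀ := by rw [ha, min_eq_right h]
      have e2 : b = t := by rw [hb, max_eq_left h]
      rw [edist_eq_enorm_sub, ← e1, ← e2]; exact hkey
  rw [← ENNReal.ofReal_add (by positivity) (by positivity)] at hed
  have hlt : ENNReal.ofReal (ε / 3 + ε / 3) < ENNReal.ofReal ε :=
    (ENNReal.ofReal_lt_ofReal_iff hε).2 (by linarith)
  exact edist_lt_ofReal.1 (hed.trans_lt hlt)

end TimeContinuity

/-! ### Space translation of the caloric and Duhamel terms -/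

section Translate

variable {F : Type*} [NormedAddCommGroup F] [NormedSpace ℝ F]

/-- **Space translation of the Duhamel term**: `B^ν_s(u(·, · + a), v(·, · + a))(t)(x) =
B^ν_s(u, v)(t)(x + a)` (the substitution `y ↦ y + a` in the space integral). [folklore] -/
theorem oseenDuhamel_comp_add_right (ν s : ℝ) (u v : ℝ → E → E) (a : E) (t : ℝ) (x : E) :
    oseenDuhamel ν s (fun τ y => u τ (y + a)) (fun τ y => v τ (y + a)) t x =
      oseenDuhamel ν s u v t (x + a) := by
  simp only [oseenDuhamel_apply]
  refine setIntegral_congr_fun measurableSet_Ioo fun τ _ => ?_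
  rw [← integral_add_right_eq_self (fun y => oseenKernel (ν * (t - τ)) (x + a - y) (u τ y) (v τ y)) a]
  refine integral_congr_ae (Eventually.of_forall fun y => ?_)
  simp only [add_sub_add_right_eq_sub]

end Translate

end Literature.Analysis.FluidPDE

end
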